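import Literature.AnabelianGeometry.EtaleTheta.Discharge.Sec5Thm57
import Literature.AnabelianGeometry.EtaleTheta.Discharge.Sec5Thm510i
import Literature.AnabelianGeometry.EtaleTheta.Discharge.Sec5Thm510OfRootTransport
import Literature.AnabelianGeometry.EtaleTheta.Discharge.Sec5Thm56
import Literature.AlgebraicGeometry.Frobenioids.ModelFrobenioidTypeBridge
import Literature.AlgebraicGeometry.Frobenioids.ModelFrobenioidOrder
import Literature.AlgebraicGeometry.Frobenioids.ModelFrobenioidPullbacks
import Literature.AlgebraicGeometry.Frobenioids.ModelFrobenioidStandardProofs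
import Literature.AlgebraicGeometry.Frobenioids.EquivalencePreStepsQuasiIsotropic
import Literature.AlgebraicGeometry.Frobenioids.EquivalenceFrobeniusQuasiIsotropic
import Literature.AlgebraicGeometry.Frobenioids.DivisorialDescriptionsIII
import Literature.AlgebraicGeometry.Frobenioids.DivisorMonoidCategoryTheoreticityProofs

/-!
# [EtTh] §5 for a MODEL tempered Frobenioid: the [FrdI] inputs of the Thm. 5.7 / 5.10 (i) / 5.6 discharges are theorems of [FrdI] Thm. 5.2 (ii), 3.4 (ii)(iii), 5.1 (iii) (pp. 303, 329, 333 / PDF pp. 77, 103, 107)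

Mochizuki, *The étale theta function …*, Publ. RIMS **45** (2009)
[cite: MochizukiEtTh2009, Thm 5.7 p.329–330 (PDF pp.103–104)]; *The geometry of Frobenioids I*, Kyushu J.
Math. **62** (2008) [cite: MochizukiFrdI2008, Thm. 5.2(ii) p.101].  Seat abc-iut-L2-d4 (wave-3 discharge of
nodes `EtTh:Thm5.7`, `EtTh:Thm5.10(i)`, `EtTh:Thm5.6`; sequel to `Discharge/Sec5Thm57.lean`, `Sec5Thm510i.lean`,
`Sec5Thm56.lean`); PROOF-ONLY.

By [EtTh] Def. 3.6 (ii) (p.303 (PDF p.77)) the tempered Frobenioid `C` of §5 "is" the model Frobenioid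
([FrdI] Thm. 5.2) of data `(D, Φ, B, B → Φ^gp)`; abc-iut-L2-t9's merge adapter `TemperedFrobenioidStub.ofModel`
(`ThetaFrobenioidOfModel.lean`) instantiates the §5 vocabulary over the tree's `ModelFrobenioid Φ B Div_B`
(abc-iut-L1-t2) with operations `PreFrobenioidData.ofModel Φ B Div_B` (abc-iut-L1-t3).  For §5 data `𝔉` of
this kind (`𝔉.pre = PreFrobenioidData.ofModel Φ B Div_B`), the three [FrdI]-level hypotheses of the
transport-up-to-a-unit step of `Sec5Thm57.lean` (`exists_codTransport_of_div_eq`: `C` totally epimorphic,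
`C` of isotropic type, Def. 1.3 (iii)(d) coslice-full) are THEOREMS of layer L1 — [FrdI] Thm. 5.2 (ii)
"`C` is a Frobenioid of isotropic type", kernel-proved by abc-iut-found / abc-iut-L1-t2/t3
(`ModelFrobenioid.isTotallyEpimorphic`, `ModelFrobenioid.ofModel_isOfIsotropicType`,
`ModelFrobenioid.iii_d_under_full`) — under the standing hypotheses of Thm. 5.2 (ii) on `(D, Φ, B)`
(`ModelFrobenioid.Hypotheses`: `Φ` divisorial, `B` group-like monoids on `D`; `D` connected and totally
epimorphic); and so is "`Ψ` preserves pre-steps" ([FrdI] Thm. 3.4 (ii), cited on p.329 via Prop. 5.1) for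
`D` of FSM-type — abc-iut-L1-t13's `FrdI.thm34ii_of_isOfFSMType` (the cell's kernel-proved form of Thm. 3.4
(ii) for quasi-isotropic Frobenioids over FSM-type bases; [EtTh] Thm. 3.7 (ii) assumes "`D` is of
FSMFF-type").  Hence, for the model case, Theorem 5.7 at the `N`-th root (`RootTransport Ψ α β`) holds MODULO
ONLY: "`Ψ` preserves base-equivalent pairs" ([FrdI] Thm. 3.4 (v); or a 1-compatible `Ψ^bs`,
`Sec5Thm57.baseEquivalent_map_of_compat`), Prop. 5.3 (vi) read at `A_N`, and the rigidity clause of Thm. 5.7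
itself (`hrig`, residual Rmk. 4.3.2 — see `Sec5Thm57.lean`).  Likewise for Theorem 5.10 (i)
(`preservesIsoClasses_of_model`): [FrdI] Thm. 5.1 (iii) "the isomorphism class of a Frobenius-trivial object … is
completely determined by … its projection to `D`" is abc-iut-L1's `PreFrobenioid.thm51iii_iso_of_baseIso` (PROVED for
every Frobenioid of isotropic type), so `PreservesIsoClasses Ψ` holds modulo: `A_N` Frobenius-trivial, "`Ψ` preserves
Frobenius-trivial objects", `Ψ(A_N)^bs ≅ A_N^bs` (Prop. 2.4) and the divisor transport at `A_N` (Prop. 5.3 (vi)).  And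
for Theorem 5.6 the binder "`Ψ` preserves linear morphisms" ([FrdI] Thm. 3.4 (iii)) of
`Sec5Thm56.cyclotomicRigidityPreserved_of` is abc-iut-L1-t13's `FrdI.thm34iii_morphisms_of_isOfFSMType` for `Φ`
non-dilating and `C` not of group-like type ([EtTh] Prop. 5.1, Thm. 3.7 (i)) — `preservesLinear_of_model`.
END-TO-END (`thm510_ii_iii_of_model`): for the model case, Theorem 5.10 (ii) and (iii) (v2 shape, `DK = ∅`) follow from
abc-iut-L2-t4's §5 `Facts` bundle (the printed defining relations p.330–331, [FrdI] Prop. 5.6, Prop. 4.3 (iii),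
Lemma 5.8's arithmetic step), a faithful 1-compatible `Ψ^bs` (Thm. 4.4 (i)), the birational square and constants
([FrdI] Prop. 4.4, Prop. 3.4 (ii)), Prop. 5.3 (vi) read at `A_N`, THE PRINTED CONCLUSION OF THM. 5.7 READ FOR THE
UNIT ("up to possible multiplication by a `2l`-th root of unity": `u^N = ζ ∈ μ_{2l}(K)` in `O^×(B_N^birat)`, `hζ`;
`mem_muTorsion_inf_OKxRootN_of_pow_eq_const` turns it into the `δ₂`-clause), and the anabelian transport data of
Thm. 4.4 (iv) / Prop. 2.4 (`θ, hstrv, hY, hYdd, ψY, …`) — every [FrdI] category-theoretic input being a theorem of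
layer L1; composed through abc-iut-L2-t4's bridge `Facts.thm510_ii_iii_of_rootTransportWith` (p411927); the general (non-model)
form of the same end-to-end statement is `thm510_ii_iii_of_div_eq`.
HONEST FRAMING: kernel-checked implications; nothing asserts that the §5 data exist for an actual curve;
typed ≠ discharged; no side is taken on anything downstream. -/

namespace Literature.AnabelianGeometry.EtaleTheta

open CategoryTheory Opposite
open Literature.AlgebraicGeometry.Frobenioids

universe w v u

/-! ### The rigidity clause of Theorem 5.7 in print's form ("multiplication by a `2l`-th root of unity") — general §5 data -/

namespace ThetaFrobenioid

section RootOfUnity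

universe w₀ v₀ v₀' u₀ u₀'

variable {C₀ : Type u₀} [Category.{v₀} C₀] {D₀ : Type u₀'} [Category.{v₀'} D₀] {𝔉 : ThetaFrobenioid.{w₀} C₀ D₀}

/-- Membership in `(O_K^×)^{1/N}`: a unit whose image in `O^×(B_N^birat)` has `N`-th power in `K^×`
(Lemma 5.8, p.331 (PDF p.105)).  [cite: MochizukiEtTh2009, Lem 5.8 p.331 (PDF p.105)] -/
theorem mem_OKxRootN_iff (u : Aut 𝔉.BN) :
    u ∈ 𝔉.OKxRootN ↔ ∃ hu : u ∈ 𝔉.units 𝔉.BN,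
      𝔉.unitsToBirat 𝔉.BN ⟨u, hu⟩ ^ (𝔉.N : ℕ) ∈ 𝔉.constEmb.range := by
  constructor
  · rintro ⟨v, hv, rfl⟩
    exact ⟨v.2, hv⟩
  · rintro ⟨hu, hk⟩
    exact ⟨⟨u, hu⟩, hk, rfl⟩

/-- **"Multiplication by a `2l`-th root of unity", read at the `N`-th root.**  If the unit `u ∈ O^×(B_N)` has
`N`-th power (in `O^×(B_N^birat)`) equal to a constant `ζ ∈ K^×` with `ζ^{2l} = 1` — i.e. `u` is an `N`-th root of
a `2l`-th root of unity of `K` (Thm. 5.7, p.330 (PDF p.104): "up to possible multiplication by a `2l`-th root of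
unity") — then `u ∈ μ_{2l·N}(B_N) ∩ (O_K^×)^{1/N}` (the `δ₂`-clause of `RootTransport` / Thm. 5.10 (ii)).  PROVED
from the injectivity of `O^×(B_N) ↪ O^×(B_N^birat)` (p.331 (PDF p.105)).
[cite: MochizukiEtTh2009, Thm 5.7 p.330 (PDF p.104); Lem 5.8 p.331 (PDF p.105)] -/
theorem mem_muTorsion_inf_OKxRootN_of_pow_eq_const {u : Aut 𝔉.BN} (hu : u ∈ 𝔉.units 𝔉.BN) (ζ : 𝔉.Kˣ)
    (hζ : ζ ^ (2 * 𝔉.l) = 1) (hpow : 𝔉.unitsToBirat 𝔉.BN ⟨u, hu⟩ ^ (𝔉.N : ℕ) = 𝔉.constEmb ζ) :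
    u ∈ 𝔉.muTorsion 𝔉.BN (2 * 𝔉.l * 𝔉.N) ⊓ 𝔉.OKxRootN := by
  refine Subgroup.mem_inf.mpr ⟨?_, (mem_OKxRootN_iff u).mpr ⟨hu, ζ, hpow.symm⟩⟩
  rw [mem_muTorsion]
  refine ⟨hu, ?_⟩
  have h1 : 𝔉.unitsToBirat 𝔉.BN (⟨u, hu⟩ ^ (2 * 𝔉.l * 𝔉.N : ℕ)) = 1 := by
    rw [map_pow, show (2 * 𝔉.l * 𝔉.N : ℕ) = (𝔉.N : ℕ) * (2 * 𝔉.l) by ring, pow_mul, hpow, ← map_pow, hζ,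
      map_one]
  have h2 : (⟨u, hu⟩ : 𝔉.units 𝔉.BN) ^ (2 * 𝔉.l * 𝔉.N : ℕ) = 1 :=
    𝔉.unitsToBirat_injective 𝔉.BN (h1.trans (map_one _).symm)
  simpa using congrArg Subtype.val h2

variable (Ψ : C₀ ≌ C₀) (α : Ψ.functor.obj 𝔉.AN ≅ 𝔉.AN) (β : Ψ.functor.obj 𝔉.BN ≅ 𝔉.BN)

/-- **[EtTh] Theorem 5.7 at the `N`-th root from its printed conclusion read for the unit.**  If `Ψ` transports
the root `(s^⊓_N, s^⊔_N)` to `(e ≫ s^⊓_N ≫ D_c, e ≫ s^⊔_N ≫ D_p)` with a UNIT discrepancy `u = D_c⁻¹ · D_p` (the step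
of the proof of Thm. 5.6 / Rmk. 5.7.1 — `Sec5Thm57.exists_codTransport_of_div_eq`) whose `N`-th power is a
`2l`-th root of unity `ζ ∈ μ_{2l}(K)` ("`Ψ` preserves … an `l`-th root of the theta function … up to possible
multiplication by a `2l`-th root of unity", Thm. 5.7 p.330 (PDF p.104) — the rigidity content, from Cor. 2.8 (i) via
Rmk. 4.3.2), then `RootTransportWith Ψ α β e D_c D_p` (abc-iut-L2-t4, p411375).
[cite: MochizukiEtTh2009, Thm 5.7 p.329–330 (PDF pp.103–104)] -/
theorem rootTransportWith_of_rootOfUnity {e : 𝔉.AN ≅ 𝔉.AN} {Dc Dp : Aut 𝔉.BN}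
    (hT : α.inv ≫ Ψ.functor.map 𝔉.sCap ≫ β.hom = e.hom ≫ 𝔉.sCap ≫ Dc.hom)
    (hT' : α.inv ≫ Ψ.functor.map 𝔉.sCup ≫ β.hom = e.hom ≫ 𝔉.sCup ≫ Dp.hom)
    (hu : Dc⁻¹ * Dp ∈ 𝔉.units 𝔉.BN) (ζ : 𝔉.Kˣ) (hζ : ζ ^ (2 * 𝔉.l) = 1)
    (hpow : 𝔉.unitsToBirat 𝔉.BN ⟨Dc⁻¹ * Dp, hu⟩ ^ (𝔉.N : ℕ) = 𝔉.constEmb ζ) :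
    𝔉.RootTransportWith Ψ α β e Dc Dp :=
  ⟨hT, hT', Dc⁻¹ * Dp, mem_muTorsion_inf_OKxRootN_of_pow_eq_const hu ζ hζ hpow, 1, one_mem _,
    (mul_one _).symm⟩

/-- **[EtTh] Theorem 5.10 (ii) and (iii), END-TO-END from primitive inputs (general §5 data).**  From: `C` totally
epimorphic and of isotropic type, [FrdI] Def. 1.3 (iii)(d) coslice-full, "`Ψ` preserves pre-steps" ([FrdI] Def. 1.3,
Thm. 5.2 (ii) / [EtTh] Thm. 3.7 (i), [FrdI] Thm. 3.4 (ii) — for a MODEL tempered Frobenioid all four are theorems of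
layer L1, see `thm510_ii_iii_of_model` below); abc-iut-L2-t4's §5 `Facts` (p.330–331); a faithful 1-compatible `Ψ^bs`
(Thm. 4.4 (i) — which also gives the preservation of base-equivalent pairs, `baseEquivalent_map_of_compat`); the
birational square and constants ([FrdI] Prop. 4.4, Prop. 3.4 (ii)); Prop. 5.3 (vi) read at `A_N` for `e` (`hcap`,
`hcup`); the printed conclusion of Thm. 5.7 read for the resulting unit (`hζ`: its `N`-th power is a `2l`-th root of
unity of `K` — the one rigidity input, Cor. 2.8 (i) via Rmk. 4.3.2); and the transport data of Thm. 4.4 (iv) /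
Prop. 2.4 — to abc-iut-L2-t4's typed Thm. 5.10 (ii) `PsiAutPreserves` and (iii) `MonoThetaEnvCompat … ∅ …`, through
`exists_codTransport_of_div_eq` (this seat, p411949), `rootTransportWith_of_rootOfUnity` and abc-iut-L2-t4's bridge
`Facts.thm510_ii_iii_of_rootTransportWith` (p411927).
[cite: MochizukiEtTh2009, Thm 5.10 (ii)(iii) p.333–335 (PDF pp.107–109); Thm 5.7 p.329–330 (PDF pp.103–104)] -/
theorem thm510_ii_iii_of_div_eq (hepi : ∀ ⦃X Y : C₀⦄ (f : X ⟶ Y), Epi f) (hiso : 𝔉.pre.IsOfIsotropicType)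
    (hiiid : ∀ ⦃A B B' : C₀⦄ (φ : A ⟶ B) (φ' : A ⟶ B'), 𝔉.pre.IsCoAngularPreStep φ →
      𝔉.pre.IsCoAngularPreStep φ' → 𝔉.pre.div φ ∣ 𝔉.pre.div φ' →
        ∃ f : B ⟶ B', 𝔉.pre.IsCoAngularPreStep f ∧ φ ≫ f = φ')
    (hpre : PreFrobenioidData.PreservesMor Ψ.functor 𝔉.IsPreStep 𝔉.IsPreStep) (H : 𝔉.Facts)
    (ΨbiratAut : 𝔉.biratUnits 𝔉.BN ≃* 𝔉.biratUnits 𝔉.BN)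
    (Ψbs : D₀ ⥤ D₀) [Ψbs.Faithful] (eΨ : Ψ.functor ⋙ 𝔉.base ≅ 𝔉.base ⋙ Ψbs)
    (hsq : ∀ u : 𝔉.units 𝔉.BN, ∀ hu : 𝔉.psiAut Ψ β u ∈ 𝔉.units 𝔉.BN,
      ΨbiratAut (𝔉.unitsToBirat 𝔉.BN u) = 𝔉.unitsToBirat 𝔉.BN ⟨_, hu⟩)
    (hconst : 𝔉.constEmb.range.map ΨbiratAut.toMonoidHom = 𝔉.constEmb.range)
    (e : 𝔉.AN ≅ 𝔉.AN)
    (hcap : 𝔉.pre.div (α.inv ≫ Ψ.functor.map 𝔉.sCap ≫ β.hom) = 𝔉.pre.div (e.hom ≫ 𝔉.sCap))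
    (hcup : 𝔉.pre.div (α.inv ≫ Ψ.functor.map 𝔉.sCup ≫ β.hom) = 𝔉.pre.div (e.hom ≫ 𝔉.sCup))
    (hζ : ∀ Dc Dp : Aut 𝔉.BN,
      α.inv ≫ Ψ.functor.map 𝔉.sCap ≫ β.hom = e.hom ≫ 𝔉.sCap ≫ Dc.hom →
      α.inv ≫ Ψ.functor.map 𝔉.sCup ≫ β.hom = e.hom ≫ 𝔉.sCup ≫ Dp.hom →
      ∀ hu : Dc⁻¹ * Dp ∈ 𝔉.units 𝔉.BN, ∃ ζ : 𝔉.Kˣ, ζ ^ (2 * 𝔉.l) = 1 ∧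
        𝔉.unitsToBirat 𝔉.BN ⟨Dc⁻¹ * Dp, hu⟩ ^ (𝔉.N : ℕ) = 𝔉.constEmb ζ)
    (θ : Aut (𝔉.base.obj 𝔉.BN) ≃* Aut (𝔉.base.obj 𝔉.BN))
    (hstrv : ∀ g : Aut (𝔉.base.obj 𝔉.BN),
      α.inv ≫ Ψ.functor.map (𝔉.strv (𝔉.autBaseIsoAB.symm g)).hom ≫ α.hom ≫ e.hom =
        e.hom ≫ (𝔉.strv (𝔉.autBaseIsoAB.symm (θ g))).hom)
    (hY : 𝔉.imPiY.map θ.toMonoidHom = 𝔉.imPiY) (hYdd : 𝔉.HB.map θ.toMonoidHom = 𝔉.HB)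
    (ψY : 𝔉.PiX ≃ₜ* 𝔉.PiX)
    (hbase : ∀ g, 𝔉.autBase 𝔉.BN (𝔉.psiAut Ψ β (𝔉.sgpCap (𝔉.ρ g))) = 𝔉.ρ (ψY g))
    (hψY : 𝔉.PiY.map ψY.toMulEquiv.toMonoidHom = 𝔉.PiY)
    (hψYdd : 𝔉.PiYdd.map ψY.toMulEquiv.toMonoidHom = 𝔉.PiYdd) :
    𝔉.PsiAutPreserves Ψ β ΨbiratAut ∧
      𝔉.MonoThetaEnvCompat H.sectionsFactor 𝔉.outerActionLZ_of H.sgpCapSection H.sgpCupSection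
        H.constantsEqNormalizer ∅ Ψ β ψY hbase hψY hψYdd := by
  obtain ⟨Dc, Dp, hT, hT', hu⟩ := exists_codTransport_of_div_eq Ψ α β hepi hiso hiiid hpre
    (fun _ _ φ ψ hb => baseEquivalent_map_of_compat Ψ Ψbs eΨ hb) e hcap hcup
  obtain ⟨ζ, hζ1, hζ2⟩ := hζ Dc Dp hT hT' hu
  exact H.thm510_ii_iii_of_rootTransportWith Ψ β ΨbiratAut Ψbs eΨ hsq hconst α e Dc Dp
    (rootTransportWith_of_rootOfUnity Ψ α β hT hT' hu ζ hζ1 hζ2) θ hstrv hY hYdd ψY hbase hψY hψYdd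

end RootOfUnity

end ThetaFrobenioid

namespace ThetaFrobenioid

variable {D : Type u} [Category.{v} D] {Φ B : Dᵒᵖ ⥤ CommMonCat.{w}} {DivB : B ⟶ monoidGp Φ}
  {𝔉 : ThetaFrobenioid.{w} (ModelFrobenioid Φ B DivB) D}

/-! ### The three [FrdI] inputs, for §5 data over a model Frobenioid -/

/-- `C = ModelFrobenioid Φ B Div_B` is totally epimorphic ([FrdI] Thm. 5.2 (ii): "`C` is a Frobenioid";
[FrdI] Def. 1.3: Frobenioids are totally epimorphic) — abc-iut-L1's `ModelFrobenioid.isTotallyEpimorphic`.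
[cite: MochizukiFrdI2008, Thm. 5.2(ii) p.101] -/
theorem epi_of_model (h : ModelFrobenioid.Hypotheses Φ B) :
    ∀ ⦃X Y : ModelFrobenioid Φ B DivB⦄ (f : X ⟶ Y), Epi f :=
  fun _ _ f => (ModelFrobenioid.isTotallyEpimorphic (DivB := DivB) h.isMonoidOn h.isDivisorial
    h.isMonoidOn_rat h.isGroupLike_rat h.isTotallyEpimorphic).epi f

/-- "`Ψ` preserves pre-steps" ([FrdI] Thm. 3.4 (ii), as cited in the proof of Thm. 5.6, p.329 (PDF p.103), via
Prop. 5.1) for a self-equivalence of the model Frobenioid over a base of FSM-type — abc-iut-L1-t13's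
`FrdI.thm34ii_of_isOfFSMType` (Frobenioid: [FrdI] Thm. 5.2 (ii); quasi-isotropic:
`ModelFrobenioid.data_isOfQuasiIsotropicType`).  [cite: MochizukiFrdI2008, Thm. 3.4 (ii) p.62] -/
theorem preservesPreSteps_of_model (h𝔉 : 𝔉.pre = PreFrobenioidData.ofModel Φ B DivB)
    (h : ModelFrobenioid.Hypotheses Φ B) (hD : IsOfFSMType D)
    (Ψ : ModelFrobenioid Φ B DivB ≌ ModelFrobenioid Φ B DivB) :
    PreFrobenioidData.PreservesMor Ψ.functor 𝔉.IsPreStep 𝔉.IsPreStep := by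
  show PreFrobenioidData.PreservesMor Ψ.functor 𝔉.pre.IsPreStep 𝔉.pre.IsPreStep
  rw [h𝔉]
  have hF := ModelFrobenioid.isFrobenioid (DivB := DivB) h.isMonoidOn h.isDivisorial h.isMonoidOn_rat
    h.isGroupLike_rat h.isGraphConnected h.isTotallyEpimorphic
  have hq := ModelFrobenioid.data_isOfQuasiIsotropicType (DivB := DivB) h
  exact (FrdI.thm34ii_of_isOfFSMType hF hF hq hq hD hD Ψ).1

/-- "`Ψ` preserves linear morphisms" ([FrdI] Thm. 3.4 (iii); the binder `hlin` of
`Sec5Thm56.cyclotomicRigidityPreserved_of`, proof of Thm. 5.6 p.328 (PDF p.102) via Prop. 5.1) for a self-equivalence of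
the model Frobenioid over a base of FSM-type with `Φ` non-dilating and `C` not of group-like type ([EtTh] Prop. 5.1
"non-dilating"; Thm. 3.7 (i) "not of group-like type") — abc-iut-L1-t13's `FrdI.thm34iii_morphisms_of_isOfFSMType`.
[cite: MochizukiFrdI2008, Thm. 3.4 (iii) p.62] -/
theorem preservesLinear_of_model (h𝔉 : 𝔉.pre = PreFrobenioidData.ofModel Φ B DivB)
    (h : ModelFrobenioid.Hypotheses Φ B) (hD : IsOfFSMType D) (hnd : IsNonDilatingOn Φ)
    (hN : ∃ A : ModelFrobenioid Φ B DivB, ¬ (PreFrobenioidData.ofModel Φ B DivB).IsGroupLikeObj A)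
    (Ψ : ModelFrobenioid Φ B DivB ≌ ModelFrobenioid Φ B DivB) :
    PreFrobenioidData.PreservesMor Ψ.functor 𝔉.IsLinear 𝔉.IsLinear := by
  show PreFrobenioidData.PreservesMor Ψ.functor 𝔉.pre.IsLinear 𝔉.pre.IsLinear
  rw [h𝔉]
  have hF := ModelFrobenioid.isFrobenioid (DivB := DivB) h.isMonoidOn h.isDivisorial h.isMonoidOn_rat
    h.isGroupLike_rat h.isGraphConnected h.isTotallyEpimorphic
  have hq := ModelFrobenioid.data_isOfQuasiIsotropicType (DivB := DivB) h
  have hnd' : (ModelFrobenioid.data Φ B DivB).IsNonDilatingOn :=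
    (ModelFrobenioid.data_isNonDilatingOn_iff Φ B DivB).mpr hnd
  exact (FrdI.thm34iii_morphisms_of_isOfFSMType hF hF hq hq hD hD hnd' hnd' Ψ hN hN).1.2.1

/-- [FrdI] Thm. 5.1 (iii), "In particular": "the isomorphism class of a Frobenius-trivial object of `C` is completely
determined by the isomorphism class of its projection to `D`" (the binder `h51` of
`Sec5Thm510i.preservesIsoClasses_of`, proof of Thm. 5.10 (i) p.334 (PDF p.108)) for §5 data over a model Frobenioid —
abc-iut-L1's `PreFrobenioid.thm51iii_iso_of_baseIso` (PROVED for Frobenioids of isotropic type), with [FrdI] Thm.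
5.2 (ii).  [cite: MochizukiFrdI2008, Thm. 5.1 (iii) p.97] -/
theorem iso_of_baseIso_of_model (h𝔉 : 𝔉.pre = PreFrobenioidData.ofModel Φ B DivB)
    (h : ModelFrobenioid.Hypotheses Φ B) :
    ∀ S T : ModelFrobenioid Φ B DivB, 𝔉.IsFrobeniusTrivial S → 𝔉.IsFrobeniusTrivial T →
      𝔉.pre.BaseIsomorphic S T → Nonempty (S ≅ T) := by
  show ∀ S T : ModelFrobenioid Φ B DivB, 𝔉.pre.IsFrobeniusTrivial S → 𝔉.pre.IsFrobeniusTrivial T →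
    𝔉.pre.BaseIsomorphic S T → Nonempty (S ≅ T)
  rw [h𝔉]
  intro S T hS hT hST
  have hF := ModelFrobenioid.isFrobenioid (DivB := DivB) h.isMonoidOn h.isDivisorial h.isMonoidOn_rat
    h.isGroupLike_rat h.isGraphConnected h.isTotallyEpimorphic
  exact PreFrobenioid.thm51iii_iso_of_baseIso (ModelFrobenioid.toElem Φ B DivB) hF
    (ModelFrobenioid.isOfIsotropicType h.isGroupLike_rat) S T
    ((PreFrobenioidData.ofFunctor_isFrobeniusTrivial _ S).mp hS)
    ((PreFrobenioidData.ofFunctor_isFrobeniusTrivial _ T).mp hT)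
    ((PreFrobenioidData.ofFunctor_baseIsomorphic _ S T).mp hST)

/-- `C` is of isotropic type ([FrdI] Thm. 5.2 (ii); [EtTh] Thm. 3.7 (i)) for §5 data whose operations are the
model's — abc-iut-L1's `ModelFrobenioid.ofModel_isOfIsotropicType`.
[cite: MochizukiFrdI2008, Thm. 5.2(ii) p.101] -/
theorem isOfIsotropicType_of_model (h𝔉 : 𝔉.pre = PreFrobenioidData.ofModel Φ B DivB)
    (hBg : Objectwise (fun M _ => IsGroupLike M) B) : 𝔉.pre.IsOfIsotropicType := by
  rw [h𝔉]
  exact ModelFrobenioid.ofModel_isOfIsotropicType Φ B DivB hBg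

/-- [FrdI] Def. 1.3 (iii)(d), coslice, full, for §5 data whose operations are the model's — abc-iut-L1's
`ModelFrobenioid.iii_d_under_full` ([FrdI] Thm. 5.2 (ii)), transported through abc-iut-L1-t3's dictionary
`PreFrobenioidData.ofFunctor_isCoAngular` / `ofFunctor_isPreStep` (`ofModel = ofFunctor ∘ toElem`
definitionally, `ModelFrobenioid.ofModel_eq_data`).  [cite: MochizukiFrdI2008, Thm. 5.2(ii) p.101] -/
theorem iiid_of_model (h𝔉 : 𝔉.pre = PreFrobenioidData.ofModel Φ B DivB)
    (hBg : Objectwise (fun M _ => IsGroupLike M) B) :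
    ∀ ⦃A X X' : ModelFrobenioid Φ B DivB⦄ (φ : A ⟶ X) (φ' : A ⟶ X'), 𝔉.pre.IsCoAngularPreStep φ →
      𝔉.pre.IsCoAngularPreStep φ' → 𝔉.pre.div φ ∣ 𝔉.pre.div φ' →
        ∃ f : X ⟶ X', 𝔉.pre.IsCoAngularPreStep f ∧ φ ≫ f = φ' := by
  rw [h𝔉]
  intro A X X' φ φ' h h' hd
  have hc : PreFrobenioid.IsCoAngularPreStep (ModelFrobenioid.toElem Φ B DivB) φ :=
    ⟨(PreFrobenioidData.ofFunctor_isCoAngular _ φ).mp h.1, (PreFrobenioidData.ofFunctor_isPreStep _ φ).mp h.2⟩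
  have hc' : PreFrobenioid.IsCoAngularPreStep (ModelFrobenioid.toElem Φ B DivB) φ' :=
    ⟨(PreFrobenioidData.ofFunctor_isCoAngular _ φ').mp h'.1,
      (PreFrobenioidData.ofFunctor_isPreStep _ φ').mp h'.2⟩
  obtain ⟨f, hf, hcomp⟩ := ModelFrobenioid.iii_d_under_full hBg φ φ' hc hc' hd
  exact ⟨f, ⟨(PreFrobenioidData.ofFunctor_isCoAngular _ f).mpr hf.1,
    (PreFrobenioidData.ofFunctor_isPreStep _ f).mpr hf.2⟩, hcomp⟩

/-! ### Theorem 5.7 at the `N`-th root, model case -/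

section Model

variable (Ψ : ModelFrobenioid Φ B DivB ≌ ModelFrobenioid Φ B DivB)
  (α : Ψ.functor.obj 𝔉.AN ≅ 𝔉.AN) (β : Ψ.functor.obj 𝔉.BN ≅ 𝔉.BN)

/-- **Transport up to a unit, model case** (proof of Thm. 5.6, p.329 (PDF p.103) / Rmk. 5.7.1): for §5 data
over a model tempered Frobenioid, given `e` matching the zero divisors of the transported sections (Prop. 5.3 (vi)
at `A_N`), there are `D_c, D_p` with `t^⊓ = e ≫ s^⊓_N ≫ D_c`, `t^⊔ = e ≫ s^⊔_N ≫ D_p`, `D_c⁻¹ · D_p ∈ O^×(B_N)` —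
the [FrdI] inputs being [FrdI] Thm. 5.2 (ii) and Thm. 3.4 (ii) (layer L1, proved; `D` of FSM-type);
remaining hypothesis: "`Ψ` preserves base-equivalent pairs" ([FrdI] Thm. 3.4 (v)).
[cite: MochizukiEtTh2009, Thm 5.6 proof p.329 (PDF p.103); Def 3.6 p.303 (PDF p.77)] -/
theorem exists_codTransport_of_div_eq_model (h𝔉 : 𝔉.pre = PreFrobenioidData.ofModel Φ B DivB)
    (h : ModelFrobenioid.Hypotheses Φ B) (hD : IsOfFSMType D)
    (hbe : ∀ ⦃A X : ModelFrobenioid Φ B DivB⦄ (φ ψ : A ⟶ X), 𝔉.pre.BaseEquivalent φ ψ →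
      𝔉.pre.BaseEquivalent (Ψ.functor.map φ) (Ψ.functor.map ψ))
    (e : 𝔉.AN ≅ 𝔉.AN)
    (hcap : 𝔉.pre.div (α.inv ≫ Ψ.functor.map 𝔉.sCap ≫ β.hom) = 𝔉.pre.div (e.hom ≫ 𝔉.sCap))
    (hcup : 𝔉.pre.div (α.inv ≫ Ψ.functor.map 𝔉.sCup ≫ β.hom) = 𝔉.pre.div (e.hom ≫ 𝔉.sCup)) :
    ∃ Dc Dp : Aut 𝔉.BN,
      α.inv ≫ Ψ.functor.map 𝔉.sCap ≫ β.hom = e.hom ≫ 𝔉.sCap ≫ Dc.hom ∧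
      α.inv ≫ Ψ.functor.map 𝔉.sCup ≫ β.hom = e.hom ≫ 𝔉.sCup ≫ Dp.hom ∧
      Dc⁻¹ * Dp ∈ 𝔉.units 𝔉.BN :=
  exists_codTransport_of_div_eq Ψ α β (epi_of_model h) (isOfIsotropicType_of_model h𝔉 h.isGroupLike_rat)
    (iiid_of_model h𝔉 h.isGroupLike_rat) (preservesPreSteps_of_model h𝔉 h hD Ψ) hbe e hcap hcup

/-- **[EtTh] Theorem 5.7 at the `N`-th root, model case** — `RootTransport Ψ α β` for §5 data over a model
tempered Frobenioid ([EtTh] Def. 3.6 (ii)) over a base of FSM-type, MODULO: "`Ψ` preserves base-equivalent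
pairs" ([FrdI] Thm. 3.4 (v) via Prop. 5.1), Prop. 5.3 (vi) read at `A_N` (`hdiv`), and the rigidity clause of
Thm. 5.7 read at level `N` (`hrig`; residual Rmk. 4.3.2) — the [FrdI]-level inputs (total epimorphicity,
isotropic type, Def. 1.3 (iii)(d), "`Ψ` preserves pre-steps") DISCHARGED by [FrdI] Thm. 5.2 (ii) and Thm. 3.4
(ii) (layer L1) under the standing hypotheses `ModelFrobenioid.Hypotheses` on `(D, Φ, B)`.
[cite: MochizukiEtTh2009, Thm 5.7 p.329–330 (PDF pp.103–104); Def 3.6 p.303 (PDF p.77)] -/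
theorem rootTransport_of_model (h𝔉 : 𝔉.pre = PreFrobenioidData.ofModel Φ B DivB)
    (h : ModelFrobenioid.Hypotheses Φ B) (hD : IsOfFSMType D)
    (hbe : ∀ ⦃A X : ModelFrobenioid Φ B DivB⦄ (φ ψ : A ⟶ X), 𝔉.pre.BaseEquivalent φ ψ →
      𝔉.pre.BaseEquivalent (Ψ.functor.map φ) (Ψ.functor.map ψ))
    (hdiv : ∃ e : 𝔉.AN ≅ 𝔉.AN,
      𝔉.pre.div (α.inv ≫ Ψ.functor.map 𝔉.sCap ≫ β.hom) = 𝔉.pre.div (e.hom ≫ 𝔉.sCap) ∧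
      𝔉.pre.div (α.inv ≫ Ψ.functor.map 𝔉.sCup ≫ β.hom) = 𝔉.pre.div (e.hom ≫ 𝔉.sCup))
    (hrig : ∀ (e : 𝔉.AN ≅ 𝔉.AN) (Dc Dp : Aut 𝔉.BN),
      α.inv ≫ Ψ.functor.map 𝔉.sCap ≫ β.hom = e.hom ≫ 𝔉.sCap ≫ Dc.hom →
      α.inv ≫ Ψ.functor.map 𝔉.sCup ≫ β.hom = e.hom ≫ 𝔉.sCup ≫ Dp.hom →
      Dc⁻¹ * Dp ∈ 𝔉.units 𝔉.BN → Dc⁻¹ * Dp ∈ 𝔉.muTorsion 𝔉.BN (2 * 𝔉.l * 𝔉.N) ⊓ 𝔉.OKxRootN) :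
    𝔉.RootTransport Ψ α β :=
  rootTransport_of Ψ α β (epi_of_model h) (isOfIsotropicType_of_model h𝔉 h.isGroupLike_rat)
    (iiid_of_model h𝔉 h.isGroupLike_rat) (preservesPreSteps_of_model h𝔉 h hD Ψ) hbe hdiv hrig

/-- **[EtTh] Theorem 5.10 (i), model case** — `PreservesIsoClasses Ψ` for §5 data over a model tempered Frobenioid
over a base of FSM-type, MODULO: `A_N` Frobenius-trivial (§5 p.322: "the [Frobenius-trivial] object defined by the
trivial line bundle"), "`Ψ` preserves Frobenius-trivial objects" ([FrdI] Thm. 3.4), `Ψ(A_N)^bs ≅ A_N^bs` (Prop. 2.4)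
and the divisor transport at `A_N` (Prop. 5.3 (vi) / Cor. 3.8 (iii)) — with [FrdI] Thm. 5.1 (iii) (`h51`), Thm. 3.4
(ii) (`hΨpre`) and the Def. 1.3 (iii)(d) determination of the codomain (`hdet`, via `exists_iso_of_div_eq`) of the
landed `Sec5Thm510i.preservesIsoClasses_of` DISCHARGED by layer L1.
[cite: MochizukiEtTh2009, Thm 5.10 (i) p.333–334 (PDF pp.107–108); Def 3.6 p.303 (PDF p.77)] -/
theorem preservesIsoClasses_of_model (h𝔉 : 𝔉.pre = PreFrobenioidData.ofModel Φ B DivB)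
    (h : ModelFrobenioid.Hypotheses Φ B) (hD : IsOfFSMType D)
    (hFT : 𝔉.IsFrobeniusTrivial 𝔉.AN)
    (hΨFT : PreFrobenioidData.PreservesObj Ψ.functor 𝔉.pre.IsFrobeniusTrivial 𝔉.pre.IsFrobeniusTrivial)
    (hbs : 𝔉.pre.BaseIsomorphic (Ψ.functor.obj 𝔉.AN) 𝔉.AN)
    (hdiv : ∀ α : Ψ.functor.obj 𝔉.AN ≅ 𝔉.AN, ∃ ε : Aut 𝔉.AN,
      𝔉.pre.div (α.inv ≫ Ψ.functor.map 𝔉.sCap) = 𝔉.pre.div (ε.hom ≫ 𝔉.sCap)) :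
    𝔉.PreservesIsoClasses Ψ :=
  preservesIsoClasses_of Ψ hFT hΨFT hbs (iso_of_baseIso_of_model h𝔉 h) (preservesPreSteps_of_model h𝔉 h hD Ψ)
    (fun φ φ' hφ hφ' hd => by
      obtain ⟨f, -⟩ := exists_iso_of_div_eq (epi_of_model h) (isOfIsotropicType_of_model h𝔉 h.isGroupLike_rat)
        (iiid_of_model h𝔉 h.isGroupLike_rat) hφ hφ' hd
      exact ⟨f⟩)
    hdiv

/-- **[EtTh] Theorem 5.10 (ii) and (iii), model case, END-TO-END from primitive inputs.**  For §5 data over a model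
tempered Frobenioid over a base of FSM-type: abc-iut-L2-t4's `Facts` (p.330–331 defining relations, [FrdI] Prop. 5.6,
Prop. 4.3 (iii), Lemma 5.8 arithmetic step, epimorphicity), a faithful 1-compatible `Ψ^bs` (Thm. 4.4 (i); it also
yields "`Ψ` preserves base-equivalent pairs", `Sec5Thm57.baseEquivalent_map_of_compat`), the birational square and
`Ψ^birat_Aut(K^×) = K^×` ([FrdI] Prop. 4.4, Prop. 3.4 (ii)), Prop. 5.3 (vi) read at `A_N` for the automorphism `e`
(`hcap`, `hcup`), the printed conclusion of Thm. 5.7 read for the resulting unit (`hζ`: its `N`-th power is a `2l`-th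
root of unity of `K`), and the transport data of Thm. 4.4 (iv) / Prop. 2.4 (`θ, hstrv, hY, hYdd, ψY, hbase, hψY,
hψYdd`) ⟹ `PsiAutPreserves Ψ β Ψ^birat_Aut` ∧ `MonoThetaEnvCompat … ∅ …` (abc-iut-L2-t4's typed Thm. 5.10 (ii),
(iii)); all [FrdI] category-theoretic inputs are theorems of layer L1, the composition is abc-iut-L2-t4's bridge
`Facts.thm510_ii_iii_of_rootTransportWith`.
[cite: MochizukiEtTh2009, Thm 5.10 (ii)(iii) p.333–335 (PDF pp.107–109); Thm 5.7 p.329–330 (PDF pp.103–104); Def 3.6 p.303 (PDF p.77)] -/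
theorem thm510_ii_iii_of_model (h𝔉 : 𝔉.pre = PreFrobenioidData.ofModel Φ B DivB)
    (h : ModelFrobenioid.Hypotheses Φ B) (hD : IsOfFSMType D) (H : 𝔉.Facts)
    (ΨbiratAut : 𝔉.biratUnits 𝔉.BN ≃* 𝔉.biratUnits 𝔉.BN)
    (Ψbs : D ⥤ D) [Ψbs.Faithful] (eΨ : Ψ.functor ⋙ 𝔉.base ≅ 𝔉.base ⋙ Ψbs)
    (hsq : ∀ u : 𝔉.units 𝔉.BN, ∀ hu : 𝔉.psiAut Ψ β u ∈ 𝔉.units 𝔉.BN,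
      ΨbiratAut (𝔉.unitsToBirat 𝔉.BN u) = 𝔉.unitsToBirat 𝔉.BN ⟨_, hu⟩)
    (hconst : 𝔉.constEmb.range.map ΨbiratAut.toMonoidHom = 𝔉.constEmb.range)
    (e : 𝔉.AN ≅ 𝔉.AN)
    (hcap : 𝔉.pre.div (α.inv ≫ Ψ.functor.map 𝔉.sCap ≫ β.hom) = 𝔉.pre.div (e.hom ≫ 𝔉.sCap))
    (hcup : 𝔉.pre.div (α.inv ≫ Ψ.functor.map 𝔉.sCup ≫ β.hom) = 𝔉.pre.div (e.hom ≫ 𝔉.sCup))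
    (hζ : ∀ Dc Dp : Aut 𝔉.BN,
      α.inv ≫ Ψ.functor.map 𝔉.sCap ≫ β.hom = e.hom ≫ 𝔉.sCap ≫ Dc.hom →
      α.inv ≫ Ψ.functor.map 𝔉.sCup ≫ β.hom = e.hom ≫ 𝔉.sCup ≫ Dp.hom →
      ∀ hu : Dc⁻¹ * Dp ∈ 𝔉.units 𝔉.BN, ∃ ζ : 𝔉.Kˣ, ζ ^ (2 * 𝔉.l) = 1 ∧
        𝔉.unitsToBirat 𝔉.BN ⟨Dc⁻¹ * Dp, hu⟩ ^ (𝔉.N : ℕ) = 𝔉.constEmb ζ)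
    (θ : Aut (𝔉.base.obj 𝔉.BN) ≃* Aut (𝔉.base.obj 𝔉.BN))
    (hstrv : ∀ g : Aut (𝔉.base.obj 𝔉.BN),
      α.inv ≫ Ψ.functor.map (𝔉.strv (𝔉.autBaseIsoAB.symm g)).hom ≫ α.hom ≫ e.hom =
        e.hom ≫ (𝔉.strv (𝔉.autBaseIsoAB.symm (θ g))).hom)
    (hY : 𝔉.imPiY.map θ.toMonoidHom = 𝔉.imPiY) (hYdd : 𝔉.HB.map θ.toMonoidHom = 𝔉.HB)
    (ψY : 𝔉.PiX ≃ₜ* 𝔉.PiX)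
    (hbase : ∀ g, 𝔉.autBase 𝔉.BN (𝔉.psiAut Ψ β (𝔉.sgpCap (𝔉.ρ g))) = 𝔉.ρ (ψY g))
    (hψY : 𝔉.PiY.map ψY.toMulEquiv.toMonoidHom = 𝔉.PiY)
    (hψYdd : 𝔉.PiYdd.map ψY.toMulEquiv.toMonoidHom = 𝔉.PiYdd) :
    𝔉.PsiAutPreserves Ψ β ΨbiratAut ∧
      𝔉.MonoThetaEnvCompat H.sectionsFactor 𝔉.outerActionLZ_of H.sgpCapSection H.sgpCupSection
        H.constantsEqNormalizer ∅ Ψ β ψY hbase hψY hψYdd :=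
  thm510_ii_iii_of_div_eq Ψ α β (epi_of_model h) (isOfIsotropicType_of_model h𝔉 h.isGroupLike_rat)
    (iiid_of_model h𝔉 h.isGroupLike_rat) (preservesPreSteps_of_model h𝔉 h hD Ψ) H ΨbiratAut Ψbs eΨ hsq hconst e
    hcap hcup hζ θ hstrv hY hYdd ψY hbase hψY hψYdd

/-- **[EtTh] Theorem 5.6, model case** — abc-iut-L2-t4's `CyclotomicRigidityPreserved Ψ ρ aΨ` for §5 data over a model
tempered Frobenioid over a base of FSM-type with `Φ` non-dilating and `C` not of group-like type ([EtTh] Prop. 5.1;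
Thm. 3.7 (i)), via this seat's landed `Sec5Thm56.cyclotomicRigidityPreserved_of` with its binder "`Ψ` preserves
linear morphisms" ([FrdI] Thm. 3.4 (iii)) DISCHARGED by layer L1 (`preservesLinear_of_model`).  Remaining inputs as
there: faithful 1-compatible `Ψ^bs` (Thm. 4.4 (i)), the transport `aΨ` of `(l·Δ_Θ) ⊗ ℤ/Nℤ` with its naturality
(Props. 2.4, 2.6), the unit pull-backs under `Ψ` (`hpull`, [FrdI] Thm. 3.4 (iv)), the Prop. 5.5 inputs
(`ρ`, `IsFunctorialLinear`, `LinearlyReachableFromBN`) and the instance at `B_N` (`hBN`, from the bi-Kummer data).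
[cite: MochizukiEtTh2009, Thm 5.6 p.328–329 (PDF pp.102–103); Def 3.6 p.303 (PDF p.77)] -/
theorem cyclotomicRigidityPreserved_of_model (h𝔉 : 𝔉.pre = PreFrobenioidData.ofModel Φ B DivB)
    (h : ModelFrobenioid.Hypotheses Φ B) (hD : IsOfFSMType D) (hnd : IsNonDilatingOn Φ)
    (hN : ∃ A : ModelFrobenioid Φ B DivB, ¬ (PreFrobenioidData.ofModel Φ B DivB).IsGroupLikeObj A)
    (Ψbs : D ⥤ D) [Ψbs.Faithful] (eΨ : Ψ.functor ⋙ 𝔉.base ≅ 𝔉.base ⋙ Ψbs)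
    (aΨ : ∀ S : ModelFrobenioid Φ B DivB, 𝔉.lDeltaModN S ≃* 𝔉.lDeltaModN (Ψ.functor.obj S))
    (ρ : FrobenioidCyclotomicRigidity.RigidityFamily 𝔉) (hB : 𝔉.IsThetaSaturated 𝔉.BN)
    (hreach : FrobenioidCyclotomicRigidity.LinearlyReachableFromBN 𝔉)
    (hρ : FrobenioidCyclotomicRigidity.IsFunctorialLinear 𝔉 ρ)
    (haΨ : ∀ {S T : ModelFrobenioid Φ B DivB} (φ : S ⟶ T) (x : 𝔉.lDeltaModN S),
      aΨ T (𝔉.lDeltaModNMap φ x) = 𝔉.lDeltaModNMap (Ψ.functor.map φ) (aΨ S x))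
    (hpull : ∀ {S T : ModelFrobenioid Φ B DivB} (φ : S ⟶ T) (u : 𝔉.muTorsion T 𝔉.N)
      (hu : Ψ.functor.mapAut T (u : Aut T) ∈ 𝔉.muTorsion (Ψ.functor.obj T) 𝔉.N),
      Ψ.functor.mapAut S (𝔉.muTorsionPull φ 𝔉.N u : Aut S) =
        (𝔉.muTorsionPull (Ψ.functor.map φ) 𝔉.N ⟨_, hu⟩ : Aut (Ψ.functor.obj S)))
    (hBN : ∀ (hΨB : 𝔉.IsThetaSaturated (Ψ.functor.obj 𝔉.BN)) (x : 𝔉.lDeltaModN 𝔉.BN),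
      (Ψ.functor.mapAut 𝔉.BN (ρ 𝔉.BN hB x : Aut 𝔉.BN) : Aut (Ψ.functor.obj 𝔉.BN)) =
        ρ (Ψ.functor.obj 𝔉.BN) hΨB (aΨ 𝔉.BN x)) :
    FrobenioidCyclotomicRigidity.CyclotomicRigidityPreserved 𝔉 Ψ ρ aΨ :=
  cyclotomicRigidityPreserved_of Ψ Ψbs eΨ aΨ ρ hB hreach hρ (preservesLinear_of_model h𝔉 h hD hnd hN Ψ) haΨ
    hpull hBN

end Model

end ThetaFrobenioid

end Literature.AnabelianGeometry.EtaleTheta
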